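/-
Copyright (c) 2026 the pub-hodgecm-mathlib formalisation cell (harness21).  Prover seat hodgecm-mathlib-K2Liu-p09 (g6): Track B «K2-LIT»,
hLiu418 = stmt-HodgeConjecture-24832; LEAD F0P6-plan RULING M-158d «A7-val road (σ)», file V8g (the `hne` glue: from a big-cell witness to the V8e binder).
-/
import Summits.HodgeConjecture.HodgeConjecture.Theorems.K2LiuA7ValueBigCellTwo            -- ★ V7b p860227 (`value_bigCell_two_ne_zero`)
import Summits.HodgeConjecture.HodgeConjecture.Theorems.K2LiuA7ValueSiegelLaw             -- ★ V1d p859834 (`exists_flatFamily`)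
import Summits.HodgeConjecture.HodgeConjecture.Theorems.K2LiuA7NormalisedRegularityCM    -- ★ B8-CM p859588 (`exists_adaptedFrame`; brings ★ B7 `normalisedRegularity`)
import Summits.HodgeConjecture.HodgeConjecture.Theorems.K2LiuA7NormalisedRegularitySetup -- ★ `volume_inter_ne_zero`
import HarnessLib

/-!
# Crux `HLiu418`, road `K2_Liu`, organ A7-val, file V8g: THE `hne` GLUE — A BIG-CELL WITNESS `Λ(𝒜 Φ₀) ≠ 0` GIVES THE WITNESS BINDER OF ★ V8e

Cell `hodgecm-mathlib`, crux item hLiu418 = `stmt-HodgeConjecture-24832`; squad K2 ∕ K2Liu; prover K2Liu-p09 (g6), organ lead A7-val.  THEOREMS ONLY; lane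
`--supports stmt-HodgeConjecture-24832` (count-neutral helper).  Generic D10 currency `F E c … v`, `n = 2`, model-generic section map `𝒜 : V →ₗ I_v(½, χ_v)`.
* **`hne_of_bigCell_witness`** — THE BINDER `hne` of ★ V8e `K2LiuA7ValueFaceTwo.face_two_of_laws` (for every Iwasawa compact open `K₀`: a vector `Φ₀`, a `K₀`-flat
  family `f` through `𝒜 Φ₀` and its normalised intertwining family `Fn` with `Fn(½)(1) ≠ 0`) FROM ONE WITNESS: a vector `Φ₀ ∈ V` whose section `𝒜 Φ₀` restricted to the
  big cell `w N_Δ` has compact support (`hsupp`) and non-zero period `Λ(𝒜 Φ₀) = ∫_{N_Δ} (𝒜 Φ₀)(w u) du ≠ 0` (`hΛ`), at a place with `χ_F(ϖ_v) ≠ 1` (`hu`; every non-split `v`).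
  Assembly: ★ V1d `exists_flatFamily` (the flat family through `𝒜 Φ₀`), ★ B8-CM `exists_adaptedFrame` + ★ B7 `normalisedRegularity` (the family `Fn`, regular at `½`,
  with `M(s) f_s = aNorm(s) · Fn(s)`), ★ V7b `value_bigCell_two_ne_zero` (`Fn(½)(1) = Λ · aNorm(½)⁻¹ ≠ 0`), ★ `volume_inter_ne_zero`.
  ⇒ the witness seats (K2Liu-p07∕p08∕p17, F7r) owe exactly `(Φ₀, C, hsupp, hΛ)` in `𝒜`-currency (at the instance: `𝒜 Φ₀ = c⁻¹ F_{Γ⁻¹Φ₀}`, ★ I-3c).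
HONEST LABEL.  `HC_CM` is proved only modulo the 7 printed citations (2 remaining named inputs: hLiu418 = `stmt-HodgeConjecture-24832`,
h413 = `stmt-HodgeConjecture-24833`) until rung 0 closes.

## References
* [KudlaSweet1997] S. Kudla, W. J. Sweet, §1, Thm. 1.2 (big-cell sections and the normalised intertwining operator at `s₀`).
* [HarrisKudlaSweet1996] M. Harris, S. Kudla, W. J. Sweet, J. AMS 9 (1996), §6 (6.16).
* [Casselman1980] W. Casselman, Compositio Math. 40 (1980), §3 (flat sections).
-/

set_option autoImplicit false
set_option linter.dupNamespace false -- the mandated namespace repeats `HodgeConjecture.HodgeConjecture`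

noncomputable section

open scoped Classical NNReal ENNReal
open NumberField IsDedekindDomain MeasureTheory Topology Set Filter
open Literature.NumberTheory.GaloisRepresentations Literature.NumberTheory.GaloisRepresentations.IsNonarchimedeanLocalField
open Literature.NumberTheory.Automorphic Literature.NumberTheory.Automorphic.UnitaryGroup
open Literature.NumberTheory.GelbartRogawski1991.UnitaryDualPair.LocalSplitting
open Literature.NumberTheory.K2Lit.LocalSiegelDoubled
open Summit.HodgeConjecture.HodgeConjecture.Cruxes.HLiu418.K2LiuQRationalDefs
open Summit.HodgeConjecture.HodgeConjecture.Cruxes.HLiu418.K2LiuLocalLFactorDefs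
open Summit.HodgeConjecture.HodgeConjecture.Cruxes.HLiu418.K2LiuLocalSiegel
open Summit.HodgeConjecture.HodgeConjecture.Cruxes.HLiu418.K2LiuLocalIntertwiningProperty
open Summit.HodgeConjecture.HodgeConjecture.Cruxes.HLiu418.K2LiuFlatSiegelFamilies
open Summit.HodgeConjecture.HodgeConjecture.Cruxes.HLiu418.K2LiuA7ValueBigCellTwo
open Summit.HodgeConjecture.HodgeConjecture.Cruxes.HLiu418.K2LiuA7ValueSiegelLaw
open Summit.HodgeConjecture.HodgeConjecture.Cruxes.HLiu418.K2LiuA7NormalisedRegularity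
open Summit.HodgeConjecture.HodgeConjecture.Cruxes.HLiu418.K2LiuA7NormalisedRegularityCM
open Summit.HodgeConjecture.HodgeConjecture.Cruxes.HLiu418.K2LiuA7NormalisedRegularitySetup

namespace Summit.HodgeConjecture.HodgeConjecture.Cruxes.HLiu418.K2LiuA7ValueWitnessGlue

variable (F : Type) [Field F] [NumberField F] (E : Type) [Field E] [NumberField E] [Algebra F E]
  [Algebra.IsQuadraticExtension F E] (c : E ≃ₐ[F] E)
  {δ : E} (hcδ : c δ = -δ) (hδ : δ ≠ 0) {d : F} (hd : δ * δ = algebraMap F E d) (v : HeightOneSpectrum (𝓞 F))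
  {T₀ : Matrix (Fin 2) (Fin 2) F} (hT₀ : T₀.IsSymm) (hT₀d : IsUnit T₀.det)
  {JD : Matrix (Fin (2 + 2)) (Fin (2 + 2)) E} (hJD : JD = (gramD F 2 T₀).map (algebraMap F E))
  {χv : ∀ w : PlacesOver E v, (w.1.adicCompletion E)ˣ →* ℂˣ} (hχ : ∀ (w : PlacesOver E v) (x : (w.1.adicCompletion E)ˣ), ‖((χv w x : ℂˣ) : ℂ)‖ = 1)
  [MeasurableSpace (unipDeltaLocal F E c v 2 (JD := JD))] [BorelSpace (unipDeltaLocal F E c v 2 (JD := JD))]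
  (νN : Measure (unipDeltaLocal F E c v 2 (JD := JD))) [νN.IsHaarMeasure]
  {V : Type*} [AddCommGroup V] [Module ℂ V] (𝒜 : V →ₗ[ℂ] ↥(localDegPS F E c hcδ hδ hd v 2 hT₀ hJD χv (1 / 2)))

include hT₀d hχ in
/-- **THE `hne` GLUE**: one big-cell witness `Φ₀` — `𝒜 Φ₀` compactly supported on `w N_Δ` (`hsupp`) with non-zero period `Λ(𝒜 Φ₀) ≠ 0` (`hΛ`) — at a place with
`χ_F(ϖ_v) ≠ 1` (`hu`) yields, for EVERY Iwasawa compact open `K₀ ≤ H_v`, the witness tuple `(Φ₀, f, Fn)` of ★ V8e's binder `hne`: `f` the `K₀`-flat family through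
`𝒜 Φ₀` (★ V1d), `Fn` its normalised intertwining family (★ B7 on ★ B8-CM's adapted frame), and `Fn(½)(1) = Λ(𝒜 Φ₀) · aNorm(½)⁻¹ ≠ 0` (★ V7b).
[cite: KudlaSweet1997, §1, Thm. 1.2] [cite: HarrisKudlaSweet1996, §6 (6.16)] [cite: Casselman1980, §3] -/
theorem hne_of_bigCell_witness (Φ₀ : V) (C : Set (unipDeltaLocal F E c v 2 (JD := JD))) (hC : IsCompact C)
    (hsupp : ∀ u : unipDeltaLocal F E c v 2 (JD := JD), u ∉ C →
      ((𝒜 Φ₀ : ↥(localDegPS F E c hcδ hδ hd v 2 hT₀ hJD χv (1 / 2))) : UnitaryGroup.localPi E c (2 + 2) JD v → ℂ)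
        (weylDelta F E c v 2 hJD * (u : UnitaryGroup.localPi E c (2 + 2) JD v)) = 0)
    (hΛ : (∫ u, ((𝒜 Φ₀ : ↥(localDegPS F E c hcδ hδ hd v 2 hT₀ hJD χv (1 / 2))) : UnitaryGroup.localPi E c (2 + 2) JD v → ℂ)
        (weylDelta F E c v 2 hJD * (u : UnitaryGroup.localPi E c (2 + 2) JD v)) ∂νN) ≠ 0)
    (hu : unramValue F v (chiF F E v χv) ≠ 1)
    (K₀ : Subgroup (UnitaryGroup.localPi E c (2 + 2) JD v))
    (hK₀ : IsCompact (K₀ : Set (UnitaryGroup.localPi E c (2 + 2) JD v)) ∧ IsOpen (K₀ : Set (UnitaryGroup.localPi E c (2 + 2) JD v)))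
    (hIw : ∀ x : UnitaryGroup.localPi E c (2 + 2) JD v, ∃ p, IsSiegelDelta F E c hcδ hδ hd v 2 hT₀ hJD p ∧ ∃ k ∈ K₀, x = p * k) :
    ∃ (Φ₁ : V) (f Fn : ℂ → UnitaryGroup.localPi E c (2 + 2) JD v → ℂ),
      (∀ s, IsLocalSiegelSection F E c hcδ hδ hd v 2 hT₀ hJD χv s (f s)) ∧ (∀ s, IsSmooth F E c v 2 (f s)) ∧ (∀ s s' : ℂ, ∀ k ∈ K₀, f s k = f s' k) ∧
      f (1 / 2) = ((𝒜 Φ₁ : ↥(localDegPS F E c hcδ hδ hd v 2 hT₀ hJD χv (1 / 2))) : UnitaryGroup.localPi E c (2 + 2) JD v → ℂ) ∧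
      (∀ h, IsQRationalRegularAt (residueFieldCard (v.adicCompletion F)) (1 / 2) fun s => Fn s h) ∧
      (∀ s : ℂ, 1 < s.re → ∀ h, localIntertwining F E c v 2 hJD νN (f s) h =
        aNorm F E c v 2 χv (νN.real {u | (u : UnitaryGroup.localPi E c (2 + 2) JD v) ∈ K₀}) s * Fn s h) ∧ Fn (1 / 2) 1 ≠ 0 := by
  -- the flat family through the smooth Siegel section `𝒜 Φ₀ ∈ I_v(½, χ_v)`
  have hmem := (𝒜 Φ₀).2
  rw [mem_localDegPS_iff] at hmem
  obtain ⟨f, hSieg, hsm, hflat, hf⟩ := exists_flatFamily F E c hcδ hδ hd v 2 hT₀ hJD χv K₀ hK₀ hIw (1 / 2) hmem.1 hmem.2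
  -- the normalised intertwining family on the adapted frame
  obtain ⟨D, Dinv, Q, hDD, hDD', hQm, hQ⟩ := exists_adaptedFrame F 2 hT₀ hT₀d
  obtain ⟨Fn, hreg, hfac⟩ := normalisedRegularity F E c hcδ hδ hd v hT₀ hJD D Dinv hDD hDD' Q hQm hQ νN χv hχ K₀ hK₀ hIw f hSieg hsm hflat
  refine ⟨Φ₀, f, Fn, hSieg, hsm, hflat, hf, hreg, hfac, ?_⟩
  -- `Fn(½)(1) = Λ · aNorm(½)⁻¹ ≠ 0`
  have hvol := volume_inter_ne_zero F E c v 2 νN K₀ hK₀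
  have hsupp' : ∀ u : unipDeltaLocal F E c v 2 (JD := JD), u ∉ C →
      f (1 / 2) (weylDelta F E c v 2 hJD * (u : UnitaryGroup.localPi E c (2 + 2) JD v)) = 0 := fun u hu' => by
    rw [hf]; exact hsupp u hu'
  have hΛ' : (∫ u, f (1 / 2) (weylDelta F E c v 2 hJD * (u : UnitaryGroup.localPi E c (2 + 2) JD v)) ∂νN) ≠ 0 := by
    rw [hf]; exact hΛ
  exact value_bigCell_two_ne_zero F E c hcδ hδ hd v hT₀ hJD hχ hvol K₀ hK₀ hIw νN hSieg hflat (hsm (1 / 2)) C hC hsupp' (hreg 1)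
    (fun s hs => hfac s hs 1) hΛ' hu

end Summit.HodgeConjecture.HodgeConjecture.Cruxes.HLiu418.K2LiuA7ValueWitnessGlue

end
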